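import Summits.BirchSwinnertonDyer.BirchSwinnertonDyer.Theorems.EisensteinDepletionAtTwoStarE1MNSFDoor
import Summits.BirchSwinnertonDyer.BirchSwinnertonDyer.Theorems.ManinLocalTwoThreeStevensIntegralityCES
import Summits.BirchSwinnertonDyer.BirchSwinnertonDyer.Theorems.ManinLocalTwoThreeAbbesUllmoCesnaviciusManinConstant
import HarnessLib

set_option autoImplicit false
-- the sub-problem namespace `Summit.BirchSwinnertonDyer.BirchSwinnertonDyer` duplicates a component by design (D-0017)
set_option linter.dupNamespace false

/-!
# Route EisensteinDepletionAtTwo, crux E1M_NSF `DepletedLambdaLawAtTwoModNSF` (stmt-BirchSwinnertonDyer-27021), closed by name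

The crux is the split parent `StarGO2Sigma ∧ StarOptBNSF` of line `star` (lead bsd-rank2-star-p1), stated MODULO MODULARITY: its first binder is
`(∀ V, ∃ g : S₂(Γ₀(N_V)), IsNewformOf V g)` — verbatim the body of `exists_isNewformOf`.  The lead's joint door
`DepletionAtTwo.KummerDoor.depletedLambdaLawAtTwoModNSF_of_modularity_gamma1_abbesUllmo_ubd` (`Theorems/EisensteinDepletionAtTwoStarE1MNSFDoor.lean`,
GEN 13, 2026-08-28: every research stub of lines `kummer` and `nsf` a tree theorem, Dedekind's `log η` law proved) derives the crux from FOUR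
named published theorems:

* modularity `exists_isNewformOf` — supplied here by the crux's OWN antecedent (no modularity theorem is used or claimed);
* Stevens' optimal `X₁(N)`-datum `exists_optimal_gamma1ParametrizationData` — the tree theorem
  `ManinLocalTwoThree.StevensIntegrality.exists_optimal_gamma1ParametrizationData_holds` (cell bsd-f2-manin; UDC-free);
* Abbes–Ullmo 1996 Thm. A `abbesUllmo_not_dvd_maninConstant_of_not_dvd_level` — the tree theorem
  `abbesUllmo_not_dvd_maninConstant_of_not_dvd_level_holds` (p828339: Stevens' inclusion ⟸ Unbounded Denominators, conjugation obstruction,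
  half-index / Kummer-value road with Stevens 1982 Thm. 1.3.1 (b));
* the Unbounded Denominators theorem `CalegariDimitrovTang2025_unboundedDenominators` — the tree theorem
  `calegariDimitrovTang2025_unboundedDenominators_holds` (p826028, line `cdt_thm1` of crux K★ stmt-BirchSwinnertonDyer-22226).

Composing closes the crux BY NAME.  No new road: this file is glue over theorems already in the tree.

DEPENDENCY / WORDING OF RECORD (director-bsd (848)(C), (849)(1)(4)).  The proof term rests on the in-tree term
`calegariDimitrovTang2025_unboundedDenominators_holds` (twice: directly and through Abbes–Ullmo) — UDC-dependent; audit (P†) pending; «kernel-closed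
(UDC-dependent, audit pending)», never «unconditional».  The crux remains stated MODULO MODULARITY (its own first binder); nothing here reads an
analytic rank; E1M and BSD are NOT proved by this file; the route's rung booking is the director's and the route pen's to state; nothing here is an
announcement.
[cite: GreenbergVatsal2000, §3 Thm. (3.12)] [cite: AbbesUllmo1996, Thm. A] [cite: Stevens1989, §2] [cite: CalegariDimitrovTang2025, Thm. 1.0.1] [cite: BCDTJAMS2001, Thm. A]
-/

namespace Summit.BirchSwinnertonDyer.BirchSwinnertonDyer.Theorems

open Literature.NumberTheory.EllipticCurves Literature.NumberTheory.EllipticCurves.ModularForms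
open Literature.NumberTheory.Automorphic

/-- **Crux E1M_NSF `DepletedLambdaLawAtTwoModNSF` (stmt-BirchSwinnertonDyer-27021), proved by name**: the crux's modularity antecedent feeds
the lead's four-print door together with the tree theorems for Stevens' optimal `X₁(N)`-datum, Abbes–Ullmo's Thm. A and the Unbounded Denominators
theorem.  UDC-dependent; audit (P†) pending; E1M and BSD are NOT proved by this.
[cite: GreenbergVatsal2000, §3 Thm. (3.12)] [cite: AbbesUllmo1996, Thm. A] [cite: Stevens1989, §2] [cite: CalegariDimitrovTang2025, Thm. 1.0.1] -/
theorem EisensteinDepletionAtTwo.DepletedLambdaLawAtTwoModNSF_proof :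
    Summit.BirchSwinnertonDyer.BirchSwinnertonDyer.Theses.EisensteinDepletionAtTwo.DepletedLambdaLawAtTwoModNSF := by
  intro hmod
  exact DepletionAtTwo.KummerDoor.depletedLambdaLawAtTwoModNSF_of_modularity_gamma1_abbesUllmo_ubd hmod
    ManinLocalTwoThree.StevensIntegrality.exists_optimal_gamma1ParametrizationData_holds
    abbesUllmo_not_dvd_maninConstant_of_not_dvd_level_holds calegariDimitrovTang2025_unboundedDenominators_holds hmod

end Summit.BirchSwinnertonDyer.BirchSwinnertonDyer.Theorems
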